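import Literature.MathematicalPhysics.QuantumFieldTheory.Balaban1983to89.Beta.KernelReflection
import Literature.MathematicalPhysics.QuantumFieldTheory.Balaban1983to89.Beta.OneStepKernelFamily
import Literature.MathematicalPhysics.QuantumFieldTheory.Balaban1983to89.Beta.KKTFluctuationUnique

/-!
# `Balaban1983to89.Beta.ResolventReflection` — the lattice reflections act on the typed one-step system: the packed
resolvents `KInv N` and `KInvStep Lc j` are REFLECTION-INVARIANT, and the typed (5.7)–(5.8) reflection law of the resolvent
Hessian kernels `TOf` / `TstepOf` / `TbalOf` follows from JET COVARIANCE

[folklore] throughout: elementary transport of structure (a lattice automorphism acting on forms, block sums, contour sums and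
kernels), linearity and UNIQUENESS of tempered solutions of the typed `U = 1` Karush–Kuhn–Tucker system
(`Beta.KKTFluctuationUnique`), and finite reindexing.  Nothing is cited; no statement of the manuscripts under audit enters; the
file declares NO `Prop`-valued definition (every named hypothesis below is a binder of a theorem).

HONEST FRAMING (cell rule, verbatim): discharging `BetaPertH` makes Bałaban's UV stability UNCONDITIONAL — a real constructive-QFT
result; it is NOT the continuum limit and NOT the Clay problem.  THIS FILE DISCHARGES NOTHING OF `BetaPertH`: it proves the
KERNEL-SIDE half of the reflection-covariance binder `hR : ∀ j, AxisReflectionCovariant (flipK (TbalOf Lc Js j))` of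
`OneStepKernelFamily.d1Drift_of_D1Tel_D1Rep` / `endpointExistence_of_D1_printed_cont` and reduces `hR` to four covariance
properties of the jet data `Js` (binders, never facts).  For the cell's DRESSED family the reduction is NOT the whole story — see
THE DRESSED FAMILY below.

VERSION v1.1 (an5 gen 17; v1 = p192895): (i) the stencil translation socket (St) of the four END forms
(`axisReflectionCovariant_flipK_hessKer` / `_TOf` / `_TstepOf` / `_TbalOf`) is RE-TYPED from fine translation
(`∀ κ′ u v, J.S κ′ (u + v) = shiftK (−v) (J.S κ′ u)` — unsatisfiable by the block stencils `vhS`, `SLam·hessFF` of the typed family,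
an2-g10 BINDER FLAG X-an2-38) to the BLOCK form (St♭) `∀ κ′ u t, J.S κ′ (u + N•t) = shiftK (−N•t) (J.S κ′ u)` (family: `Lc•t`), through the
new strictly-weaker-hypothesis lemma `vertexOfK_translate_block` (§5); every other v1 declaration is byte-identical and every v1 proof
term elaborates unchanged; (ii) docstring fix (beta-lit2-g21 XREAD D1): the blocking of `refK_dec`'s right member reads `Φ (M * N) α`.

## The reflection

The reflection of the axis `α` used here is the lattice automorphism `sref α : x_α ↦ −1 − x_α` (other coordinates fixed).  Unlike
`x_α ↦ −x_α` it is BLOCK-COMPATIBLE for every blocking factor `L` simultaneously: the `L`-block of label `y` is mapped onto the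
`L`-block of label `sref α y` (`sref_block`, `quo_sref`), so the block sums, the straight-contour sums and the adjoint contour sums
of `Beta.AffineAveraging` / `Beta.AffineReproduction` commute with it (`blockSum_R0`, `contourSum_R1`, `contourSumAdj_R1`), and so do
`dz`, `codiff₁`, `curv`, `curvAdj` (`dz_R0`, `codiff₁_R1`, `curv_R1`, `curvAdj_R2`).  On bonds it acts by the affine map
`bref α κ` (= `KernelReflection.bondRefl α 1 κ`, `bref_eq_bondRefl`: an `α`-bond is reversed and re-based at its other endpoint)
with the orientation sign `PolarizationSign.reflSign α κ`; the pull-backs are `R0`, `R1`, `R2`.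

## What is proved

* §1–§2  the reflection, its pull-backs, and the commutation with every operator of the typed `U = 1` system (above).
* §3  TRANSPORT: a tempered solution of `KKTFluctuationUnique.SolvesKKT N F c A φ μ` reflects to a tempered solution with reflected
  data (`solvesKKT_reflect`), scales (`solvesKKT_smul`) and block-translates (`solvesKKT_shift`); temperedness is preserved
  (`tempered1_R1`, `tempered0_R0`, `tempered1_shift`, …).
* §4  THE REFLECTION LEG MAP `Φ N α : KernelReflection.LegMap (d+1) (Fib d)` (field legs by `bref α κ`, multiplier legs by
  `mref N α κ : u_α ↦ −N − u_α − [κ = α] N`, which preserves the coarse sublattice, `proj_mref_eq_zero_iff`, `mref_zsmul`; signs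
  `reflSign α κ`), and **`refK_KInv : refK (Φ N α) (KInv N) = KInv N`** — the packed one-step resolvent of
  `Beta.OneStepResolventKernel` is reflection-invariant, every axis, every `N ≥ 1`, any dimension.  Proof: the four blocks `Γ`, `Φ`,
  `ℋ`, `wΦ` are columns of tempered KKT solutions (`KKTFluctuationUnique.solvesKKT_Gam`, `solvesKKT_wH`); the reflected,
  sign-corrected column solves the system with the reflected source (`Gam_reflect`, `wH_reflect`), hence equals the column at the
  reflected source by uniqueness (`eq_Gam_of_solvesKKT`, `unique_of_solvesKKT`) — no formula for the kernels is used.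
* §5  for ANY packed kernel `K` with `refK (Φ N α) K = K`: reflection covariance of its `ℋ`-column (`colH_reflect`) and of the
  chain-rule vertex through it for a reflection-covariant stencil family (`vertexOfK_reflect`, `vertexOf_reflect`) — the hypothesis
  `hVr` of `KernelReflection.hess_refl`; and **`axisReflectionCovariant_flipK_hessKer`**: for `K` decaying, block-covariant and
  reflection-invariant and a jet datum `J` with (St) block-translation covariant stencils, (Wt) block-covariant second-order vertices,
  (Sr) reflection-covariant stencils `J.S κ′ (bref α κ′ u) = ε_κ′ • refK (Φ N α) (J.S κ′ u)`, (Wr) reflection-covariant second-order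
  vertices, the flipped kernel `flipK (hessKer K (vertexOfK K N J.S) J.W)` satisfies `PolarizationSign.AxisReflectionCovariant`
  VERBATIM (via `KernelReflection.axisReflectionCovariant_flip_hessKer`, rates matched by monotonicity).  Instance
  `axisReflectionCovariant_flipK_TOf` (`K = KInv N`).
* §6  the reflection COMMUTES WITH BLOCK-CONTOUR DECIMATION (`refK_dec : refK (Φ N α) (dec M K) = dec M (refK (Φ (M * N) α) K)`: the
  block-contour leg sets of `OneStepKernelFamily.dec` are reflection-symmetric, `legPt_reflect`, `sum_legFlip`), hence
  **`refK_KInvStep : refK (Φ Lc α) (KInvStep Lc j) = KInvStep Lc j`** for every step `j`, and the typed reflection law of the GENUINE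
  step kernels from jet covariance: `axisReflectionCovariant_flipK_TstepOf`, and for the one-step family in dimension four
  **`axisReflectionCovariant_flipK_TbalOf : (St) → (Wt) → (Sr) → (Wr) → ∀ j, AxisReflectionCovariant (flipK (TbalOf Lc Js j))`** —
  the literal `hR` binder, with every kernel-side input (decay, block covariance, reflection invariance of each `KInvStep Lc j`)
  a theorem of this package.

## The dressed family (WHAT IS NOT HERE)

The cell's family is `JsBal N Lc := fun j ↦ AxialDressing.dress (JsBal⁰ N Lc j)`.  For it the binders (Sr)/(Wr) of §6 do NOT hold
on the nose and are not claimed: the axial dressing is built on ONE block tree (the comb rooted at the block origin), and the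
reflection `sref α` carries that tree to the comb rooted at the `α`-opposite corner — a DIFFERENT slice.  Transport of structure (this
file's method) therefore yields, for the dressed kernel, covariance UP TO THE CHANGE OF TREE; the remaining input is
TREE-INDEPENDENCE of the dressed Hessian kernel (model: `OrbitPolarization.polarization_eq_of_forests`, with `SliceComposition` §6),
whose source is the Ward/gauge-covariance data of Bałaban's jets ((D-i)), not the jet datum's localisation fields.  Typed over the
names in the tree (one tree only), tree-independence between the comb and its reflections is EQUIVALENT to the reflection law of the
dressed kernel itself, so it cannot be separated here without a dressing functor for a general block tree; it is NAMED, not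
discharged, and its owner is for the β-lead to rule.  What this file gives the dressed family unconditionally is the kernel side:
`refK_KInvStep` (the undressed resolvent at every step is reflection-invariant) and `refK_dec`.

Also not here: the Ward binder `hW`; any jet of Bałaban's (the four covariances are hypotheses about `Js`); `D1Tel`, `D1Rep`,
`D1Drift`; anything of `(M2⁺)` / EXIT-A.

## Dependences (by name)

`Beta.KernelReflection` (`LegMap`, `refK`, `bondRefl`, `axisReflectionCovariant_flip_hessKer`), `Beta.OneStepKernelFamily` (`dec`,
`KInvStep`, `colH`, `vertexOfK`, `TstepOf`, `TbalOf`, `flipK`; through it `Beta.OneStepResolventKernel`: `KInv`, `vertexOf`, `JetData`,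
`TOf`), `Beta.KKTFluctuationUnique` (`SolvesKKT`, `Tempered0/1`, `unique_of_solvesKKT`, `eq_Gam_of_solvesKKT`, `solvesKKT_Gam`,
`solvesKKT_wH`), `Beta.KernelSpecInstance` (`wH`, `wΦ`, `wM`, their decay, the shift lemmas), `Beta.KKTFluctuationKernel` (`Gam`, `GamΦ`,
`GamM`, `delta1`), `Beta.AffineAveraging` / `Beta.AffineReproduction` (the operators), `Beta.PolarizationSign` (`axisReflect`,
`reflSign`, `AxisReflectionCovariant`).
-/

namespace Literature.MathematicalPhysics.QuantumFieldTheory.Balaban1983to89.Beta.ResolventReflection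

noncomputable section

open Finset
open scoped BigOperators
open Literature.Probability.LatticeModels (TorusSite Torus.proj Torus.proj_apply)
open AffineAveraging (Form0 Form1 Form2 unitVec unitVec_apply dz curv curvAdj codiff₁ box toSite blockSum contourSum)
open AffineReproduction (contourSumAdj IsBlockConst)
open LatticeForm (repZ quo proj_repZ proj_add_zsmul)
open BlochFibreUniqueness (quo_add_zsmul)
open PolarizationSign (axisReflect axisReflect_apply reflSign AxisReflectionCovariant)
open KernelReflection (LegMap refK refK_apply bondRefl axisReflectionCovariant_flip_hessKer)
open KKTFluctuationUnique (SolvesKKT Tempered0 Tempered1 unique_of_solvesKKT eq_Gam_of_solvesKKT solvesKKT_Gam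
  solvesKKT_wH tempered_Gam tempered_GamΦ tempered_GamM abs_le_of_decay510)
open KKTFluctuationKernel (Gam GamΦ GamM delta1 delta1_apply)
open KernelSpecInstance (wH wΦ wM decay_wH decay_wΦ decay_wM opEL_shift opG_shift opM_shift contourSum_shift
  contourSumAdj_shift curv_smul curvAdj_smul codiff₁_smul dz_smul contourSum_smul contourSumAdj_smul)
open KKTFluctuationKernel (blockSum_shift l1_sub_le)
open OneStepResolventKernel (Fib KInv KInv_inl_inl KInv_inl_inr_coarse KInv_inr_inl_coarse KInv_inr_inr_coarse KInv_inl_inr_off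
  KInv_inr_off proj_zsmul quo_zsmul eq_zsmul_quo_of_proj decays_KInv shiftK_KInv decays_mono biLoc_mono LocStencil vertexOf JetData
  TOf)
open OneStepKernelFamily (dec legSet legPt legW LegIdx KInvStep decays_KInvStep shiftK_KInvStep colH vertexOfK vertexOfK_KInv
  vertexOfK_translate vertexFamily_vertexOfK' TstepOf TbalOf flipK)
open ExpKernelCalculus (Decays BiLoc VertexFamily VertexFamily₂ hessKer shiftK BlockCovariant)
open B12Sec2to5 (l1 l1_nonneg Decay510)

variable {D : ℕ}

/-! ## §1 The block-compatible reflection of one lattice axis and its action on forms -/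

/-- THE BLOCK-COMPATIBLE REFLECTION OF AXIS `α`: `x_α ↦ −1 − x_α`, all other coordinates fixed.  It maps the block
`[N w_α, N w_α + N)` onto the block of `−1 − w_α` for EVERY `N`, so the SAME formula is the induced map of block indices.
[folklore] -/
def sref (α : Fin D) (x : Fin D → ℤ) : (Fin D → ℤ) := fun i => if i = α then -1 - x i else x i

/-- Coordinates of the reflected site. [folklore] -/
@[simp] theorem sref_apply (α : Fin D) (x : Fin D → ℤ) (i : Fin D) : sref α x i = if i = α then -1 - x i else x i := rfl

/-- `sref α` is an involution. [folklore] -/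
@[simp] theorem sref_sref (α : Fin D) (x : Fin D → ℤ) : sref α (sref α x) = x := by
  funext i; by_cases hi : i = α <;> simp [hi]

/-- `sref α` is affine with linear part `axisReflect α`. [folklore] -/
theorem sref_add (α : Fin D) (x v : Fin D → ℤ) : sref α (x + v) = sref α x + axisReflect α v := by
  funext i; by_cases hi : i = α <;> simp [hi]; ring

/-- The site reflection on a difference. [folklore] -/
theorem sref_sub (α : Fin D) (x v : Fin D → ℤ) : sref α (x - v) = sref α x - axisReflect α v := by
  funext i; by_cases hi : i = α <;> simp [hi]; ring

/-- THE BASE-POINT MAP OF `κ`-BONDS under the reflection: a reflected `α`-bond is re-based at its other endpoint, so the base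
point of the image of the bond `⟨x, x + e_κ⟩` is `sref α x − [κ = α] e_α`.  (This is `KernelReflection.bondRefl α 1 κ`, the
block-preserving offset `c = 1`: `bref_eq_bondRefl`.) [folklore] -/
def bref (α κ : Fin D) (x : Fin D → ℤ) : (Fin D → ℤ) := sref α x - if κ = α then unitVec α else 0

/-- Coordinates of the reflected bond base point. [folklore] -/
theorem bref_apply (α κ : Fin D) (x : Fin D → ℤ) (i : Fin D) :
    bref α κ x i = if i = α then -1 - x i - (if κ = α then 1 else 0) else x i := by
  unfold bref
  by_cases hi : i = α
  · subst hi; by_cases hκ : κ = i <;> simp [hκ, unitVec_apply]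
  · by_cases hκ : κ = α <;> simp [hκ, hi, unitVec_apply]

/-- `bref α κ` is an involution. [folklore] -/
@[simp] theorem bref_bref (α κ : Fin D) (x : Fin D → ℤ) : bref α κ (bref α κ x) = x := by
  funext i; rw [bref_apply, bref_apply]; by_cases hi : i = α <;> simp [hi]; ring

/-- The bond map on a translate: `bref (x + v) = bref x + εv`. [folklore] -/
theorem bref_add (α κ : Fin D) (x v : Fin D → ℤ) : bref α κ (x + v) = bref α κ x + axisReflect α v := by
  unfold bref; rw [sref_add]; abel

/-- The bond map on a difference. [folklore] -/
theorem bref_sub (α κ : Fin D) (x v : Fin D → ℤ) : bref α κ (x - v) = bref α κ x - axisReflect α v := by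
  unfold bref; rw [sref_sub]; abel

/-- For `κ ≠ α` the base-point map is the site map. [folklore] -/
theorem bref_of_ne {α κ : Fin D} (h : κ ≠ α) (x : Fin D → ℤ) : bref α κ x = sref α x := by
  simp [bref, h]

/-- An `α`-bond is re-based at its other endpoint: `bref α α x = sref α x − e_α`. [folklore] -/
theorem bref_self (α : Fin D) (x : Fin D → ℤ) : bref α α x = sref α x - unitVec α := by
  simp [bref]

/-- `axisReflect α` of a coarse multiple. [folklore] -/
theorem axisReflect_zsmul (α : Fin D) (n : ℤ) (v : Fin D → ℤ) : axisReflect α (n • v) = n • axisReflect α v := by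
  funext i; by_cases hi : i = α <;> simp [hi]

/-- The linear reflection fixes the unit vectors of the other axes. [folklore] -/
theorem axisReflect_unitVec_of_ne {α κ : Fin D} (h : κ ≠ α) : axisReflect α (unitVec κ) = unitVec κ := by
  funext i
  by_cases hi : i = α
  · subst hi; simp [unitVec_apply, Ne.symm h]
  · simp [hi, unitVec_apply]

/-- The linear reflection reverses the unit vector of its axis. [folklore] -/
theorem axisReflect_unitVec_self (α : Fin D) : axisReflect α (unitVec α) = -unitVec α := by
  funext i; by_cases hi : i = α <;> simp [hi, unitVec_apply]

/-- The identification with `KernelReflection.bondRefl α 1`. [folklore] -/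
theorem bref_eq_bondRefl (α κ : Fin D) (x : Fin D → ℤ) : bref α κ x = bondRefl α 1 κ x := by
  funext i
  rw [bref_apply]
  unfold KernelReflection.bondRefl
  simp only [Pi.sub_apply, Pi.smul_apply, axisReflect_apply, B6BondElimination.unitVec, smul_eq_mul]
  by_cases hi : i = α
  · subst hi; by_cases hκ : κ = i <;> simp [hκ] <;> ring
  · simp [hi]

/-- THE SIGN of a `κ`-leg under the reflection of axis `α` (`PolarizationSign.reflSign`) squares to one. [folklore] -/
theorem reflSign_mul_self (α κ : Fin D) : reflSign α κ * reflSign α κ = 1 := by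
  unfold PolarizationSign.reflSign; split_ifs <;> norm_num

/-- The sign of a transverse direction is `+1`. [folklore] -/
theorem reflSign_of_ne {α κ : Fin D} (h : κ ≠ α) : reflSign α κ = 1 := by simp [PolarizationSign.reflSign, h]

/-- The sign of the reflected direction is `−1`. [folklore] -/
theorem reflSign_self (α : Fin D) : reflSign α α = -1 := by simp [PolarizationSign.reflSign]

/-- PULLBACK OF 0-FORMS. [folklore] -/
def R0 (α : Fin D) (f : Form0 D ℝ) : Form0 D ℝ := fun x => f (sref α x)

/-- PULLBACK OF 1-FORMS (orientation sign on `α`-bonds, re-based). [folklore] -/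
def R1 (α : Fin D) (A : Form1 D ℝ) : Form1 D ℝ := fun κ x => reflSign α κ * A κ (bref α κ x)

/-- PULLBACK OF 2-FORMS (plaquette functions on ordered pairs of directions). [folklore] -/
def R2 (α : Fin D) (F : Form2 D ℝ) : Form2 D ℝ :=
  fun κ l x => reflSign α κ * reflSign α l * F κ l (sref α x - (if κ = α then unitVec α else 0) - (if l = α then unitVec α else 0))

/-- Entries of the pulled-back scalar. [folklore] -/
@[simp] theorem R0_apply (α : Fin D) (f : Form0 D ℝ) (x : Fin D → ℤ) : R0 α f x = f (sref α x) := rfl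
/-- Entries of the pulled-back 1-form. [folklore] -/
@[simp] theorem R1_apply (α : Fin D) (A : Form1 D ℝ) (κ : Fin D) (x : Fin D → ℤ) :
    R1 α A κ x = reflSign α κ * A κ (bref α κ x) := rfl
/-- Entries of the pulled-back 2-form. [folklore] -/
theorem R2_apply (α : Fin D) (F : Form2 D ℝ) (κ l : Fin D) (x : Fin D → ℤ) :
    R2 α F κ l x = reflSign α κ * reflSign α l *
      F κ l (sref α x - (if κ = α then unitVec α else 0) - (if l = α then unitVec α else 0)) := rfl

/-- The 1-form pull-back is an involution. [folklore] -/
theorem R1_R1 (α : Fin D) (A : Form1 D ℝ) : R1 α (R1 α A) = A := by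
  funext κ x; simp only [R1_apply, bref_bref, ← mul_assoc, reflSign_mul_self, one_mul]

/-- The scalar pull-back is an involution. [folklore] -/
theorem R0_R0 (α : Fin D) (f : Form0 D ℝ) : R0 α (R0 α f) = f := by
  funext x; simp only [R0_apply, sref_sref]

/-- The 1-form pull-back of `0`. [folklore] -/
theorem R1_zero (α : Fin D) : R1 α (0 : Form1 D ℝ) = 0 := by
  funext κ x; simp

/-- The 1-form pull-back is additive. [folklore] -/
theorem R1_add (α : Fin D) (A B : Form1 D ℝ) : R1 α (A + B) = R1 α A + R1 α B := by
  funext κ x; simp [mul_add]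

/-- The 1-form pull-back is homogeneous. [folklore] -/
theorem R1_smul (α : Fin D) (a : ℝ) (A : Form1 D ℝ) : R1 α (a • A) = a • R1 α A := by
  funext κ x; simp; ring

/-- The scalar pull-back is homogeneous. [folklore] -/
theorem R0_smul (α : Fin D) (a : ℝ) (f : Form0 D ℝ) : R0 α (a • f) = a • R0 α f := by
  funext x; simp

/-! ## §2 Covariance of the lattice operators of the `U = 1` KKT system -/

/-- `d` on 0-forms commutes with the reflection. [folklore] -/
theorem dz_R0 (α : Fin D) (f : Form0 D ℝ) : dz (R0 α f) = R1 α (dz f) := by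
  funext κ x
  simp only [dz, R0_apply, R1_apply, sref_add]
  by_cases hκ : κ = α
  · subst hκ
    rw [reflSign_self, bref_self, axisReflect_unitVec_self, sub_add_cancel]
    simp only [neg_mul, one_mul, neg_sub]
    rfl
  · rw [reflSign_of_ne hκ, bref_of_ne hκ, axisReflect_unitVec_of_ne hκ, one_mul]


/-- `δ` on 1-forms commutes with the reflection. [folklore] -/
theorem codiff₁_R1 (α : Fin D) (A : Form1 D ℝ) : codiff₁ (R1 α A) = R0 α (codiff₁ A) := by
  funext x
  simp only [codiff₁, R0_apply, R1_apply]
  refine Finset.sum_congr rfl fun κ _ => ?_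
  by_cases hκ : κ = α
  · subst hκ
    rw [reflSign_self, bref_self, bref_self, sref_sub, axisReflect_unitVec_self, sub_neg_eq_add, add_sub_cancel_right]
    ring
  · rw [reflSign_of_ne hκ, bref_of_ne hκ, bref_of_ne hκ, sref_sub, axisReflect_unitVec_of_ne hκ, one_mul, one_mul]

/-- The curvature commutes with the reflection. [folklore] -/
theorem curv_R1 (α : Fin D) (A : Form1 D ℝ) : curv (R1 α A) = R2 α (curv A) := by
  funext κ l x
  simp only [curv, R1_apply, R2_apply]
  by_cases hκ : κ = α <;> by_cases hl : l = α
  · subst hκ; subst hl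
    simp only [reflSign_self]; ring
  · subst hκ
    simp only [reflSign_self, reflSign_of_ne hl, bref_self, bref_of_ne hl, sref_add, axisReflect_unitVec_self,
      axisReflect_unitVec_of_ne hl, if_true, if_neg hl, sub_zero]
    abel_nf; ring_nf
  · subst hl
    simp only [reflSign_self, reflSign_of_ne hκ, bref_self, bref_of_ne hκ, sref_add, axisReflect_unitVec_self,
      axisReflect_unitVec_of_ne hκ, if_true, if_neg hκ, sub_zero]
    abel_nf; ring_nf
  · simp only [reflSign_of_ne hκ, reflSign_of_ne hl, bref_of_ne hκ, bref_of_ne hl, sref_add,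
      axisReflect_unitVec_of_ne hκ, axisReflect_unitVec_of_ne hl, if_neg hκ, if_neg hl, sub_zero, one_mul]

/-- The adjoint curvature commutes with the reflection. [folklore] -/
theorem curvAdj_R2 (α : Fin D) (G : Form2 D ℝ) : curvAdj (R2 α G) = R1 α (curvAdj G) := by
  funext μ y
  simp only [curvAdj, R1_apply, R2_apply, mul_add, Finset.mul_sum]
  congr 1
  · refine Finset.sum_congr rfl fun l _ => ?_
    by_cases hl : l = α
    · subst hl
      by_cases hμ : μ = l
      · subst hμ
        simp only [reflSign_self, bref_self, sref_sub, axisReflect_unitVec_self, if_true]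
        abel_nf; ring_nf
      · simp only [reflSign_self, reflSign_of_ne hμ, bref_of_ne hμ, sref_sub, axisReflect_unitVec_self, if_true, if_neg hμ,
          sub_zero]
        abel_nf; ring_nf
    · by_cases hμ : μ = α
      · subst hμ
        simp only [reflSign_self, reflSign_of_ne hl, bref_self, sref_sub, axisReflect_unitVec_of_ne hl, if_true, if_neg hl,
          sub_zero]
        abel_nf; ring_nf
      · simp only [reflSign_of_ne hμ, reflSign_of_ne hl, bref_of_ne hμ, sref_sub, axisReflect_unitVec_of_ne hl, if_neg hμ,
          if_neg hl, sub_zero, one_mul]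
  · refine Finset.sum_congr rfl fun κ _ => ?_
    by_cases hκ : κ = α
    · subst hκ
      by_cases hμ : μ = κ
      · subst hμ
        simp only [reflSign_self, bref_self, sref_sub, axisReflect_unitVec_self, if_true]
        abel_nf; ring_nf
      · simp only [reflSign_self, reflSign_of_ne hμ, bref_of_ne hμ, sref_sub, axisReflect_unitVec_self, if_true, if_neg hμ,
          sub_zero]
        abel_nf; ring_nf
    · by_cases hμ : μ = α
      · subst hμ
        simp only [reflSign_self, reflSign_of_ne hκ, bref_self, sref_sub, axisReflect_unitVec_of_ne hκ, if_true, if_neg hκ,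
          sub_zero]
        abel_nf; ring_nf
      · simp only [reflSign_of_ne hμ, reflSign_of_ne hκ, bref_of_ne hμ, sref_sub, axisReflect_unitVec_of_ne hκ, if_neg hμ,
          if_neg hκ, sub_zero, one_mul]

/-! ### Box reindexing -/

/-- The reflection of a box offset along the axis `α`: `b_α ↦ L − 1 − b_α`. [folklore] -/
def bflip (α : Fin D) (L : ℕ) (b : Fin D → ℕ) : Fin D → ℕ := fun i => if i = α then L - 1 - b i else b i

/-- Membership in the box of offsets. [folklore] -/
theorem mem_box {L : ℕ} {b : Fin D → ℕ} : b ∈ box D L ↔ ∀ i, b i < L := by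
  simp [AffineAveraging.box, Fintype.mem_piFinset, Finset.mem_range]

/-- The offset flip preserves the box. [folklore] -/
theorem bflip_mem (α : Fin D) {L : ℕ} {b : Fin D → ℕ} (hb : b ∈ box D L) : bflip α L b ∈ box D L := by
  rw [mem_box] at hb ⊢
  intro i
  unfold bflip
  have := hb i
  split_ifs <;> omega

/-- The offset flip is an involution on the box. [folklore] -/
theorem bflip_bflip (α : Fin D) {L : ℕ} {b : Fin D → ℕ} (hb : b ∈ box D L) : bflip α L (bflip α L b) = b := by
  funext i
  unfold bflip
  have := mem_box.1 hb i
  by_cases hi : i = α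
  · simp only [hi, if_true]
    have := mem_box.1 hb α
    omega
  · simp [hi]

/-- Reindexing a box sum by the offset reflection. [folklore] -/
theorem sum_box_bflip {M : Type*} [AddCommMonoid M] (α : Fin D) (L : ℕ) (g : (Fin D → ℕ) → M) :
    ∑ b ∈ box D L, g (bflip α L b) = ∑ b ∈ box D L, g b :=
  Finset.sum_nbij' (bflip α L) (bflip α L) (fun _ hb => bflip_mem α hb) (fun _ hb => bflip_mem α hb)
    (fun _ hb => bflip_bflip α hb) (fun _ hb => bflip_bflip α hb) (fun _ _ => rfl)

/-- Coordinates of an offset read as a site. [folklore] -/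
theorem toSite_apply (b : Fin D → ℕ) (i : Fin D) : toSite b i = (b i : ℤ) := rfl

/-- Coordinates of the flipped offset read as a site. [folklore] -/
theorem toSite_bflip (α : Fin D) {L : ℕ} {b : Fin D → ℕ} (hb : b ∈ box D L) (i : Fin D) :
    toSite (bflip α L b) i = if i = α then (L : ℤ) - 1 - (b i : ℤ) else (b i : ℤ) := by
  rw [toSite_apply]
  unfold bflip
  by_cases hi : i = α
  · simp only [hi, if_true]
    have := mem_box.1 hb α
    omega
  · simp [hi]

/-- The reflection maps the block of `y` onto the block of `sref α y`, offsets reflected. [folklore] -/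
theorem sref_block (α : Fin D) {L : ℕ} {b : Fin D → ℕ} (hb : b ∈ box D L) (y : Fin D → ℤ) :
    sref α ((L : ℤ) • y + toSite b) = (L : ℤ) • sref α y + toSite (bflip α L b) := by
  funext i
  simp only [sref_apply, Pi.add_apply, Pi.smul_apply, smul_eq_mul, toSite_bflip α hb, toSite_apply]
  by_cases hi : i = α
  · simp only [hi, if_true]; ring
  · simp [hi]

/-- Block sums commute with the reflection. [folklore] -/
theorem blockSum_R0 (α : Fin D) (L : ℕ) (f : Form0 D ℝ) : blockSum L (R0 α f) = R0 α (blockSum L f) := by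
  funext y
  simp only [blockSum, R0_apply]
  rw [← sum_box_bflip α L (fun b => f ((L : ℤ) • sref α y + toSite b))]
  exact Finset.sum_congr rfl fun b hb => by rw [sref_block α hb]

/-- Block-constancy is preserved by the reflection. [folklore] -/
theorem isBlockConst_R0 (α : Fin D) {L : ℕ} [NeZero L] {g : Form0 D ℝ} (hg : IsBlockConst L g) :
    IsBlockConst L (R0 α g) := by
  have h0 : (fun _ => 0 : Fin D → ℕ) ∈ box D L := mem_box.2 fun _ => Nat.pos_of_ne_zero (NeZero.ne L)
  have e : ∀ y : Fin D → ℤ, sref α ((L : ℤ) • y) = (L : ℤ) • sref α y + toSite (bflip α L fun _ => 0) := by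
    intro y
    have := sref_block α h0 y
    have hz : toSite (fun _ => 0 : Fin D → ℕ) = 0 := by funext i; simp [toSite_apply]
    rwa [hz, add_zero] at this
  intro y b hb
  simp only [R0_apply]
  rw [sref_block α hb, hg _ _ (bflip_mem α hb), e, hg _ _ (bflip_mem α h0)]

/-- Straight-contour block sums commute with the reflection (for `κ = α` the contour is traversed backwards from the reflected
block: offsets AND steps are reflected). [folklore] -/
theorem contourSum_R1 (α : Fin D) (L : ℕ) (A : Form1 D ℝ) : contourSum L (R1 α A) = R1 α (contourSum L A) := by
  funext κ y
  simp only [contourSum, R1_apply]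
  by_cases hκ : κ = α
  · subst hκ
    simp only [reflSign_self, neg_mul, one_mul, Finset.sum_neg_distrib, Finset.mul_sum]
    congr 1
    rw [← sum_box_bflip κ L (fun b => ∑ s ∈ Finset.range L,
      A κ (bref κ κ ((L : ℤ) • y + toSite b + (s : ℤ) • unitVec κ)))]
    refine Finset.sum_congr rfl fun b hb => ?_
    rw [← Finset.sum_range_reflect]
    refine Finset.sum_congr rfl fun s hs => ?_
    have hsL : s < L := Finset.mem_range.1 hs
    congr 1
    rw [bref_self, sref_add, sref_block κ (bflip_mem κ hb), bflip_bflip κ hb, axisReflect_zsmul, axisReflect_unitVec_self,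
      bref_self]
    funext i
    simp only [Pi.add_apply, Pi.sub_apply, Pi.smul_apply, smul_eq_mul, sref_apply, unitVec_apply, Pi.neg_apply]
    by_cases hi : i = κ
    · simp only [hi, if_true]; push_cast [Nat.sub_sub, Nat.cast_sub (show 1 + s ≤ L by omega)]; ring
    · simp [hi]
  · simp only [reflSign_of_ne hκ, bref_of_ne hκ, one_mul]
    rw [← sum_box_bflip α L (fun b => ∑ s ∈ Finset.range L, A κ ((L : ℤ) • sref α y + toSite b + (s : ℤ) • unitVec κ))]
    refine Finset.sum_congr rfl fun b hb => Finset.sum_congr rfl fun s _ => ?_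
    rw [sref_add, sref_block α hb, axisReflect_zsmul, axisReflect_unitVec_of_ne hκ]


/-! ### The adjoint block-average operator `𝒬ᵀ` -/

/-- Euclidean division by `N > 0` of a reflected coordinate: `⌊(−1 − m)/N⌋ = −1 − ⌊m/N⌋`. [folklore] -/
theorem neg_one_sub_ediv (m : ℤ) {N : ℤ} (hN : 0 < N) : (-1 - m) / N = -1 - m / N := by
  have h := Int.mul_ediv_add_emod m N
  have h0 := Int.emod_nonneg m hN.ne'
  have h1 := Int.emod_lt_of_pos m hN
  have e : -1 - m = (N - 1 - m % N) + N * (-1 - m / N) := by linarith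
  rw [e, Int.add_mul_ediv_left _ _ hN.ne', Int.ediv_eq_zero_of_lt (by omega) (by omega)]
  ring

/-- Block indices commute with the reflection: `quo N ∘ sref α = sref α ∘ quo N`. [folklore] -/
theorem quo_sref (α : Fin D) {N : ℕ} [NeZero N] (z : Fin D → ℤ) : quo N (sref α z) = sref α (quo N z) := by
  have hN : (0 : ℤ) < N := by exact_mod_cast Nat.pos_of_ne_zero (NeZero.ne N)
  funext i
  simp only [quo, sref_apply]
  by_cases hi : i = α
  · simp only [hi, if_true]; exact neg_one_sub_ediv _ hN
  · simp [hi]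

/-- The point identity behind `contourSumAdj_R1` on the reflected axis: the block of the `s`-th fine `α`-bond below `x`,
reflected and re-based, is the block of the `(N − 1 − s)`-th fine `α`-bond below the reflected re-based point. [folklore] -/
theorem bref_quo_self (α : Fin D) {N : ℕ} [NeZero N] (x : Fin D → ℤ) {s : ℕ} (hs : s < N) :
    bref α α (quo N (x - (s : ℤ) • unitVec α)) = quo N (bref α α x - ((N - 1 - s : ℕ) : ℤ) • unitVec α) := by
  have hN : (0 : ℤ) < N := by exact_mod_cast Nat.pos_of_ne_zero (NeZero.ne N)
  funext i
  rw [bref_apply]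
  simp only [quo, Pi.sub_apply, Pi.smul_apply, smul_eq_mul, unitVec_apply, bref_apply]
  by_cases hi : i = α
  · subst hi
    simp only [if_true, mul_one]
    have hc : ((N - 1 - s : ℕ) : ℤ) = (N : ℤ) - 1 - (s : ℤ) := by omega
    rw [hc]
    have e : -1 - x i - 1 - ((N : ℤ) - 1 - (s : ℤ)) = (-1 - (x i - (s : ℤ))) + (N : ℤ) * (-1) := by ring
    rw [e, Int.add_mul_ediv_left _ _ hN.ne', neg_one_sub_ediv _ hN]
    ring
  · simp [hi]

/-- The adjoint contour sum, unfolded with the block index `quo`. [folklore] -/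
theorem contourSumAdj_eq {N : ℕ} (φ : Form1 D ℝ) (κ : Fin D) (x : Fin D → ℤ) :
    contourSumAdj N φ κ x = ∑ s ∈ Finset.range N, φ κ (quo N (x - (s : ℤ) • unitVec κ)) := rfl

/-- `𝒬ᵀ` commutes with the reflection (for `κ = α` the `N` contours through a fine bond are enumerated backwards). [folklore] -/
theorem contourSumAdj_R1 (α : Fin D) {N : ℕ} [NeZero N] (φ : Form1 D ℝ) :
    contourSumAdj N (R1 α φ) = R1 α (contourSumAdj N φ) := by
  have hN0 : (N : ℤ) ≠ 0 := by exact_mod_cast NeZero.ne N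
  funext κ x
  simp only [R1_apply, contourSumAdj_eq, Finset.mul_sum]
  by_cases hκ : κ = α
  · subst hκ
    conv_rhs => rw [← Finset.sum_range_reflect]
    refine Finset.sum_congr rfl fun s hs => ?_
    have hsN : s < N := Finset.mem_range.1 hs
    congr 2
    exact bref_quo_self κ x hsN
  · refine Finset.sum_congr rfl fun s _ => ?_
    rw [bref_of_ne hκ, bref_of_ne hκ, ← quo_sref, sref_sub, axisReflect_zsmul, axisReflect_unitVec_of_ne hκ]

/-! ## §3 Transport of the KKT system: reflection, scaling, block translation; temperedness -/

section Transport

variable {d N : ℕ} [NeZero N]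

/-- **THE `U = 1` KKT SYSTEM IS REFLECTION-COVARIANT**: the reflected triple solves the system with the reflected force and the
reflected block averages. [folklore] -/
theorem solvesKKT_reflect (α : Fin (d + 1)) {F c A φ : Form1 (d + 1) ℝ} {μ : Form0 (d + 1) ℝ} (h : SolvesKKT N F c A φ μ) :
    SolvesKKT N (R1 α F) (R1 α c) (R1 α A) (R1 α φ) (R0 α μ) where
  el κ x := by
    have e1 : curvAdj (curv (R1 α A)) = R1 α (curvAdj (curv A)) := by rw [curv_R1, curvAdj_R2]
    have e2 : dz (codiff₁ (dz (R0 α μ))) = R1 α (dz (codiff₁ (dz μ))) := by rw [dz_R0, codiff₁_R1, dz_R0]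
    rw [e1, e2, contourSumAdj_R1]
    simp only [R1_apply]
    rw [h.el]
    ring
  gauge := by
    have e : codiff₁ (dz (codiff₁ (R1 α A))) = R0 α (codiff₁ (dz (codiff₁ A))) := by rw [codiff₁_R1, dz_R0, codiff₁_R1]
    rw [e]
    exact isBlockConst_R0 α h.gauge
  mean y := by
    rw [blockSum_R0]
    exact h.mean _
  avg κ y := by
    rw [contourSum_R1]
    simp only [R1_apply]
    rw [h.avg]

omit [NeZero N] in
/-- The KKT system is linear: scaling a solution. [folklore] -/
theorem solvesKKT_smul (a : ℝ) {F c A φ : Form1 (d + 1) ℝ} {μ : Form0 (d + 1) ℝ} (h : SolvesKKT N F c A φ μ) :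
    SolvesKKT N (a • F) (a • c) (a • A) (a • φ) (a • μ) where
  el κ x := by
    rw [curv_smul, curvAdj_smul, contourSumAdj_smul, dz_smul, codiff₁_smul, dz_smul]
    simp only [Pi.smul_apply, smul_eq_mul]
    rw [h.el]
    ring
  gauge y b hb := by
    rw [codiff₁_smul, dz_smul, codiff₁_smul]
    simp only [Pi.smul_apply, smul_eq_mul]
    rw [h.gauge y b hb]
  mean y := by
    have : blockSum N (a • μ) y = a * blockSum N μ y := by
      simp only [blockSum, Pi.smul_apply, smul_eq_mul, Finset.mul_sum]
    rw [this, h.mean, mul_zero]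
  avg κ y := by
    rw [contourSum_smul]
    simp only [Pi.smul_apply, smul_eq_mul]
    rw [h.avg]

/-- The KKT system is block-translation covariant: translating the fine fields by `N • q` and the coarse fields by `q`.
[folklore] -/
theorem solvesKKT_shift (q : Fin (d + 1) → ℤ) {F c A φ : Form1 (d + 1) ℝ} {μ : Form0 (d + 1) ℝ}
    (h : SolvesKKT N F c A φ μ) :
    SolvesKKT N (fun κ z => F κ (z - (N : ℤ) • q)) (fun κ p => c κ (p - q)) (fun κ z => A κ (z - (N : ℤ) • q))
      (fun κ p => φ κ (p - q)) (fun z => μ (z - (N : ℤ) • q)) where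
  el κ x := by
    rw [opEL_shift, contourSumAdj_shift, opM_shift]
    exact h.el κ _
  gauge y b hb := by
    rw [opG_shift, opG_shift]
    have e1 : (N : ℤ) • y + toSite b - (N : ℤ) • q = (N : ℤ) • (y - q) + toSite b := by rw [smul_sub]; abel
    have e2 : (N : ℤ) • y - (N : ℤ) • q = (N : ℤ) • (y - q) := by rw [smul_sub]
    rw [e1, e2]
    exact h.gauge (y - q) b hb
  mean y := by
    rw [blockSum_shift]
    exact h.mean _
  avg κ y := by
    rw [contourSum_shift]
    exact h.avg κ _

/-- A reflected coordinate grows by at most `2` in absolute value. [folklore] -/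
theorem abs_refl_coord_le (t : ℤ) (c : ℤ) (hc : 0 ≤ c) (hc2 : c ≤ 1) :
    |((-1 - t - c : ℤ) : ℝ)| ≤ |((t : ℤ) : ℝ)| + 2 := by
  have hc' : (0 : ℝ) ≤ c ∧ (c : ℝ) ≤ 1 := ⟨by exact_mod_cast hc, by exact_mod_cast hc2⟩
  push_cast
  have h1 : |-(1 : ℝ) - (t : ℝ) - (c : ℝ)| = |(t : ℝ) + (1 + (c : ℝ))| := by
    rw [show -(1 : ℝ) - (t : ℝ) - (c : ℝ) = -((t : ℝ) + (1 + (c : ℝ))) by ring, abs_neg]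
  rw [h1]
  calc |(t : ℝ) + (1 + (c : ℝ))| ≤ |(t : ℝ)| + |1 + (c : ℝ)| := abs_add_le _ _
    _ ≤ |(t : ℝ)| + 2 := by rw [abs_of_nonneg (show (0 : ℝ) ≤ 1 + (c : ℝ) by linarith)]; linarith

/-- The `ℓ¹` size of a reflected base point. [folklore] -/
theorem l1_bref_le (α κ : Fin (d + 1)) (x : Fin (d + 1) → ℤ) : l1 (bref α κ x) ≤ l1 x + 2 := by
  have key : ∀ i, |((bref α κ x i : ℤ) : ℝ)| ≤ |((x i : ℤ) : ℝ)| + if i = α then 2 else 0 := by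
    intro i
    rw [bref_apply]
    by_cases hi : i = α
    · simp only [hi, if_true]
      by_cases hκ : κ = α
      · simp only [hκ, if_true]; exact abs_refl_coord_le (x α) 1 (by norm_num) (by norm_num)
      · simp only [hκ, if_false]; exact abs_refl_coord_le (x α) 0 (by norm_num) (by norm_num)
    · simp [hi]
  calc l1 (bref α κ x) = ∑ i, |((bref α κ x i : ℤ) : ℝ)| := rfl
    _ ≤ ∑ i, (|((x i : ℤ) : ℝ)| + if i = α then 2 else 0) := Finset.sum_le_sum fun i _ => key i
    _ = l1 x + 2 := by rw [Finset.sum_add_distrib, Finset.sum_ite_eq' Finset.univ α]; simp [l1]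

/-- The `ℓ¹` size of a reflected site. [folklore] -/
theorem l1_sref_le (α : Fin (d + 1)) (x : Fin (d + 1) → ℤ) : l1 (sref α x) ≤ l1 x + 2 := by
  have key : ∀ i, |((sref α x i : ℤ) : ℝ)| ≤ |((x i : ℤ) : ℝ)| + if i = α then 2 else 0 := by
    intro i
    rw [sref_apply]
    by_cases hi : i = α
    · simp only [hi, if_true]
      have := abs_refl_coord_le (x α) 0 (by norm_num) (by norm_num)
      rwa [sub_zero] at this
    · simp [hi]
  calc l1 (sref α x) = ∑ i, |((sref α x i : ℤ) : ℝ)| := rfl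
    _ ≤ ∑ i, (|((x i : ℤ) : ℝ)| + if i = α then 2 else 0) := Finset.sum_le_sum fun i _ => key i
    _ = l1 x + 2 := by rw [Finset.sum_add_distrib, Finset.sum_ite_eq' Finset.univ α]; simp [l1]

/-- Temperedness is preserved by the reflection (1-forms). [folklore] -/
theorem tempered1_R1 (α : Fin (d + 1)) {A : Form1 (d + 1) ℝ} (hA : Tempered1 A) : Tempered1 (R1 α A) := by
  obtain ⟨C, m, hC⟩ := hA
  refine ⟨|C| * 3 ^ m, m, fun κ x => ?_⟩
  rw [R1_apply, abs_mul]
  have hs : |reflSign α κ| = 1 := by unfold PolarizationSign.reflSign; split_ifs <;> simp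
  rw [hs, one_mul]
  have h1 := hC κ (bref α κ x)
  have hl := l1_bref_le α κ x
  have h0 : 0 ≤ 1 + l1 (bref α κ x) := by have := l1_nonneg (bref α κ x); linarith
  calc |A κ (bref α κ x)| ≤ C * (1 + l1 (bref α κ x)) ^ m := h1
    _ ≤ |C| * (1 + l1 (bref α κ x)) ^ m := by
        exact mul_le_mul_of_nonneg_right (le_abs_self C) (pow_nonneg h0 m)
    _ ≤ |C| * (3 * (1 + l1 x)) ^ m := by
        refine mul_le_mul_of_nonneg_left (pow_le_pow_left₀ h0 (by linarith [l1_nonneg x]) m) (abs_nonneg C)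
    _ = |C| * 3 ^ m * (1 + l1 x) ^ m := by rw [mul_pow]; ring

/-- Temperedness is preserved by the reflection (0-forms). [folklore] -/
theorem tempered0_R0 (α : Fin (d + 1)) {f : Form0 (d + 1) ℝ} (hf : Tempered0 f) : Tempered0 (R0 α f) := by
  obtain ⟨C, m, hC⟩ := hf
  refine ⟨|C| * 3 ^ m, m, fun x => ?_⟩
  rw [R0_apply]
  have h1 := hC (sref α x)
  have hl := l1_sref_le α x
  have h0 : 0 ≤ 1 + l1 (sref α x) := by have := l1_nonneg (sref α x); linarith
  calc |f (sref α x)| ≤ C * (1 + l1 (sref α x)) ^ m := h1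
    _ ≤ |C| * (1 + l1 (sref α x)) ^ m := mul_le_mul_of_nonneg_right (le_abs_self C) (pow_nonneg h0 m)
    _ ≤ |C| * (3 * (1 + l1 x)) ^ m := by
        refine mul_le_mul_of_nonneg_left (pow_le_pow_left₀ h0 (by linarith [l1_nonneg x]) m) (abs_nonneg C)
    _ = |C| * 3 ^ m * (1 + l1 x) ^ m := by rw [mul_pow]; ring

/-- Temperedness is preserved by scaling. [folklore] -/
theorem tempered1_smul (a : ℝ) {A : Form1 (d + 1) ℝ} (hA : Tempered1 A) : Tempered1 (a • A) := by
  obtain ⟨C, m, hC⟩ := hA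
  refine ⟨|a| * C, m, fun κ x => ?_⟩
  rw [Pi.smul_apply, Pi.smul_apply, smul_eq_mul, abs_mul, mul_assoc]
  exact mul_le_mul_of_nonneg_left (hC κ x) (abs_nonneg a)

/-- Temperedness is preserved by scaling (scalars). [folklore] -/
theorem tempered0_smul (a : ℝ) {f : Form0 (d + 1) ℝ} (hf : Tempered0 f) : Tempered0 (a • f) := by
  obtain ⟨C, m, hC⟩ := hf
  refine ⟨|a| * C, m, fun x => ?_⟩
  rw [Pi.smul_apply, smul_eq_mul, abs_mul, mul_assoc]
  exact mul_le_mul_of_nonneg_left (hC x) (abs_nonneg a)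

/-- Temperedness is preserved by translation (1-forms). [folklore] -/
theorem tempered1_shift (v : Fin (d + 1) → ℤ) {A : Form1 (d + 1) ℝ} (hA : Tempered1 A) :
    Tempered1 (fun κ z => A κ (z - v)) := by
  obtain ⟨C, m, hC⟩ := hA
  refine ⟨|C| * (1 + l1 v) ^ m, m, fun κ z => ?_⟩
  have h1 := hC κ (z - v)
  have hl := l1_sub_le z v
  have h0 : 0 ≤ 1 + l1 (z - v) := by have := l1_nonneg (z - v); linarith
  have hv := l1_nonneg v
  have hz := l1_nonneg z
  calc |A κ (z - v)| ≤ C * (1 + l1 (z - v)) ^ m := h1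
    _ ≤ |C| * (1 + l1 (z - v)) ^ m := mul_le_mul_of_nonneg_right (le_abs_self C) (pow_nonneg h0 m)
    _ ≤ |C| * ((1 + l1 v) * (1 + l1 z)) ^ m := by
        refine mul_le_mul_of_nonneg_left (pow_le_pow_left₀ h0 (by nlinarith) m) (abs_nonneg C)
    _ = |C| * (1 + l1 v) ^ m * (1 + l1 z) ^ m := by rw [mul_pow]; ring

/-- Temperedness is preserved by translation (0-forms). [folklore] -/
theorem tempered0_shift (v : Fin (d + 1) → ℤ) {f : Form0 (d + 1) ℝ} (hf : Tempered0 f) :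
    Tempered0 (fun z => f (z - v)) := by
  obtain ⟨C, m, hC⟩ := hf
  refine ⟨|C| * (1 + l1 v) ^ m, m, fun z => ?_⟩
  have h1 := hC (z - v)
  have hl := l1_sub_le z v
  have h0 : 0 ≤ 1 + l1 (z - v) := by have := l1_nonneg (z - v); linarith
  have hv := l1_nonneg v
  have hz := l1_nonneg z
  calc |f (z - v)| ≤ C * (1 + l1 (z - v)) ^ m := h1
    _ ≤ |C| * (1 + l1 (z - v)) ^ m := mul_le_mul_of_nonneg_right (le_abs_self C) (pow_nonneg h0 m)
    _ ≤ |C| * ((1 + l1 v) * (1 + l1 z)) ^ m := by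
        refine mul_le_mul_of_nonneg_left (pow_le_pow_left₀ h0 (by nlinarith) m) (abs_nonneg C)
    _ = |C| * (1 + l1 v) ^ m * (1 + l1 z) ^ m := by rw [mul_pow]; ring

end Transport


/-! ## §4 The reflection leg map and the invariance of the packed resolvent -/

/-- THE MULTIPLIER-LEG MAP of the reflection at blocking `N`: the multiplier legs of `KInv` live at the fine points `N • q` of the
coarse sublattice; `u_α ↦ −N − u_α − [κ = α] N` sends `N • q ↦ N • bref α κ q` and preserves the sublattice. [folklore] -/
def mref (N : ℕ) (α κ : Fin D) (u : Fin D → ℤ) : Fin D → ℤ :=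
  fun i => if i = α then -(N : ℤ) - u i - (if κ = α then (N : ℤ) else 0) else u i

/-- The multiplier-leg map is an involution. [folklore] -/
@[simp] theorem mref_mref (N : ℕ) (α κ : Fin D) (u : Fin D → ℤ) : mref N α κ (mref N α κ u) = u := by
  funext i; unfold mref; by_cases hi : i = α <;> simp [hi]; ring

/-- The multiplier-leg map on the coarse sublattice: `mref (N • q) = N • bref q`. [folklore] -/
theorem mref_zsmul (N : ℕ) (α κ : Fin D) (q : Fin D → ℤ) : mref N α κ ((N : ℤ) • q) = (N : ℤ) • bref α κ q := by
  funext i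
  simp only [mref, Pi.smul_apply, smul_eq_mul, bref_apply]
  by_cases hi : i = α
  · simp only [hi, if_true]
    by_cases hκ : κ = α <;> simp [hκ] <;> ring
  · simp [hi]

section Resolvent

variable {d N : ℕ}

/-- **THE REFLECTION LEG MAP** of axis `α` at blocking `N` (an instance of `KernelReflection.LegMap`): field legs `inl κ` are moved
by the bond base-point map `bref α κ = bondRefl α 1 κ`, multiplier legs `inr κ` by `mref N α κ`; both carry the sign
`reflSign α κ`. [folklore] -/
def Φ (N : ℕ) (α : Fin (d + 1)) : LegMap (d + 1) (Fib d) where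
  r a := match a with
    | Sum.inl κ => Function.Involutive.toPerm (bref α κ) (bref_bref α κ)
    | Sum.inr κ => Function.Involutive.toPerm (mref N α κ) (mref_mref N α κ)
  s a := match a with
    | Sum.inl κ => reflSign α κ
    | Sum.inr κ => reflSign α κ
  s_mul_s a := by cases a <;> exact reflSign_mul_self _ _

/-- The field legs of the reflection leg map are moved by `bref`. [folklore] -/
@[simp] theorem Φ_r_inl (α κ : Fin (d + 1)) (x : Fin (d + 1) → ℤ) : (Φ (d := d) N α).r (Sum.inl κ) x = bref α κ x := rfl
/-- The multiplier legs of the reflection leg map are moved by `mref`. [folklore] -/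
@[simp] theorem Φ_r_inr (α κ : Fin (d + 1)) (x : Fin (d + 1) → ℤ) : (Φ (d := d) N α).r (Sum.inr κ) x = mref N α κ x := rfl
/-- The sign of a field leg. [folklore] -/
@[simp] theorem Φ_s_inl (α κ : Fin (d + 1)) : (Φ (d := d) N α).s (Sum.inl κ) = reflSign α κ := rfl
/-- The sign of a multiplier leg. [folklore] -/
@[simp] theorem Φ_s_inr (α κ : Fin (d + 1)) : (Φ (d := d) N α).s (Sum.inr κ) = reflSign α κ := rfl

/-- Changing the data `(F, c)` of `SolvesKKT` along equalities. [folklore] -/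
theorem solvesKKT_congr {F F' c c' A φ : Form1 (d + 1) ℝ} {μ : Form0 (d + 1) ℝ} (hF : F = F') (hc : c = c')
    (h : SolvesKKT N F c A φ μ) : SolvesKKT N F' c' A φ μ := by
  subst hF; subst hc; exact h

variable [NeZero N]

/-- The multiplier-leg map preserves (non-)membership in the coarse sublattice. [folklore] -/
theorem proj_mref_eq_zero_iff (α κ : Fin (d + 1)) (u : Fin (d + 1) → ℤ) :
    Torus.proj N (mref N α κ u) = 0 ↔ Torus.proj N u = 0 := by
  constructor
  · intro h
    have e := eq_zsmul_quo_of_proj (N := N) h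
    have : u = mref N α κ ((N : ℤ) • quo N (mref N α κ u)) := by rw [← e, mref_mref]
    rw [this, mref_zsmul]
    exact proj_zsmul _
  · intro h
    rw [eq_zsmul_quo_of_proj (N := N) h, mref_zsmul]
    exact proj_zsmul _

/-- The reflected unit force: `ε_l • R1 α (δ_{(l, x′)}) = δ_{(l, bref α l x′)}`. [folklore] -/
theorem smul_R1_delta1 (α l : Fin (d + 1)) (x' : Fin (d + 1) → ℤ) :
    reflSign α l • R1 α (delta1 l x') = delta1 l (bref α l x') := by
  funext κ x
  simp only [Pi.smul_apply, smul_eq_mul, R1_apply, delta1_apply]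
  by_cases hκ : κ = l
  · subst hκ
    by_cases hx : x = bref α κ x'
    · have : bref α κ x = x' := by rw [hx, bref_bref]
      simp [hx, reflSign_mul_self]
    · have : bref α κ x ≠ x' := fun h => hx (by rw [← h, bref_bref])
      simp [hx, this]
  · simp [hκ]

/-- **REFLECTION COVARIANCE OF THE FLUCTUATION COVARIANCE COLUMNS** (`Γ`, `Φ`, `M` of `Beta/KKTFluctuationKernel`): the reflected,
sign-corrected column at the source bond `(l, x′)` is the column at the reflected source bond — by the uniqueness of tempered
solutions (`KKTFluctuationUnique.eq_Gam_of_solvesKKT`). [folklore] -/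
theorem Gam_reflect (α l : Fin (d + 1)) (x' : Fin (d + 1) → ℤ) :
    (reflSign α l • R1 α (fun κ x => Gam (N := N) κ x l x') = fun κ x => Gam (N := N) κ x l (bref α l x')) ∧
    (reflSign α l • R1 α (fun κ q => GamΦ (N := N) κ q l x') = fun κ q => GamΦ (N := N) κ q l (bref α l x')) ∧
    (reflSign α l • R0 α (fun z => GamM (N := N) z l x') = fun z => GamM (N := N) z l (bref α l x')) := by
  have h0 := solvesKKT_Gam (N := N) l x'
  have h1 := solvesKKT_smul (reflSign α l) (solvesKKT_reflect α h0)
  have h2 : SolvesKKT N (delta1 l (bref α l x')) 0 (reflSign α l • R1 α fun κ x => Gam (N := N) κ x l x')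
      (reflSign α l • R1 α fun κ q => GamΦ (N := N) κ q l x') (reflSign α l • R0 α fun z => GamM (N := N) z l x') :=
    solvesKKT_congr (smul_R1_delta1 α l x') (by rw [R1_zero, smul_zero]) h1
  exact eq_Gam_of_solvesKKT h2 (tempered1_smul _ (tempered1_R1 α (tempered_Gam l x')))
    (tempered1_smul _ (tempered1_R1 α (tempered_GamΦ l x'))) (tempered0_smul _ (tempered0_R0 α (tempered_GamM l x')))

/-- Pointwise form of `Gam_reflect` for `Γ`. [folklore] -/
theorem Gam_bref (α κ l : Fin (d + 1)) (x x' : Fin (d + 1) → ℤ) :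
    reflSign α l * (reflSign α κ * Gam (N := N) κ (bref α κ x) l x') = Gam (N := N) κ x l (bref α l x') := by
  have h := congrFun (congrFun (Gam_reflect (N := N) α l x').1 κ) x
  simpa only [Pi.smul_apply, smul_eq_mul, R1_apply] using h

/-- Pointwise form of `Gam_reflect` for `Φ = GamΦ`. [folklore] -/
theorem GamΦ_bref (α κ l : Fin (d + 1)) (q x' : Fin (d + 1) → ℤ) :
    reflSign α l * (reflSign α κ * GamΦ (N := N) κ (bref α κ q) l x') = GamΦ (N := N) κ q l (bref α l x') := by
  have h := congrFun (congrFun (Gam_reflect (N := N) α l x').2.1 κ) q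
  simpa only [Pi.smul_apply, smul_eq_mul, R1_apply] using h

/-- The minimiser column is tempered (bounded, by `Decay510`). [folklore] -/
theorem tempered_wH (l : Fin (d + 1)) : Tempered1 (fun κ z => wH (N := N) κ l z) := by
  obtain ⟨δ₁, C₁, hδ₁, h₁⟩ := decay_wH (N := N) (d := d)
  exact Tempered1.of_bounded fun κ z => abs_le_of_decay510 hδ₁ (h₁ κ l) z

/-- The multiplier column is tempered (bounded, by `Decay510`). [folklore] -/
theorem tempered_wΦ (l : Fin (d + 1)) : Tempered1 (fun κ y => wΦ (N := N) κ l y) := by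
  obtain ⟨δ₂, C₂, hδ₂, h₂⟩ := decay_wΦ (N := N) (d := d)
  exact Tempered1.of_bounded fun κ y => abs_le_of_decay510 hδ₂ (h₂ κ l) y

/-- The mean-multiplier column is tempered (bounded, by `Decay510`). [folklore] -/
theorem tempered_wM (l : Fin (d + 1)) : Tempered0 (wM (N := N) l) := by
  obtain ⟨δ₃, C₃, hδ₃, h₃⟩ := decay_wM (N := N) (d := d)
  exact Tempered0.of_bounded fun z => abs_le_of_decay510 hδ₃ (h₃ l) z

/-- **REFLECTION COVARIANCE OF THE MINIMISER COLUMNS** (`wH`, `wΦ`, `wM` of `Beta/KernelSpecInstance`): the reflected,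
sign-corrected column `l` is the column of the coarse bond `(l, bref α l 0)`, i.e. the block translate by `bref α l 0` — by the
uniqueness of tempered solutions (`KKTFluctuationUnique.unique_of_solvesKKT`). [folklore] -/
theorem wH_reflect (α l : Fin (d + 1)) :
    (reflSign α l • R1 α (fun κ z => wH (N := N) κ l z) = fun κ z => wH (N := N) κ l (z - (N : ℤ) • bref α l 0)) ∧
    (reflSign α l • R1 α (fun κ y => wΦ (N := N) κ l y) = fun κ y => wΦ (N := N) κ l (y - bref α l 0)) ∧
    (reflSign α l • R0 α (wM (N := N) l) = fun z => wM (N := N) l (z - (N : ℤ) • bref α l 0)) := by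
  have h0 := solvesKKT_wH (N := N) l
  have h1 := solvesKKT_smul (reflSign α l) (solvesKKT_reflect α h0)
  have hc : reflSign α l • R1 α (fun κ y => if y = 0 ∧ κ = l then (1 : ℝ) else 0)
      = fun κ p => if p - bref α l 0 = 0 ∧ κ = l then (1 : ℝ) else 0 := by
    funext κ p
    simp only [Pi.smul_apply, smul_eq_mul, R1_apply, sub_eq_zero]
    by_cases hκ : κ = l
    · subst hκ
      by_cases hp : p = bref α κ 0
      · have : bref α κ p = 0 := by rw [hp, bref_bref]
        simp [hp, reflSign_mul_self]
      · have : bref α κ p ≠ 0 := fun h => hp (by rw [← h, bref_bref])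
        simp [hp, this]
    · simp [hκ]
  have h2 : SolvesKKT N 0 (fun κ p => if p - bref α l 0 = 0 ∧ κ = l then (1 : ℝ) else 0)
      (reflSign α l • R1 α fun κ z => wH (N := N) κ l z) (reflSign α l • R1 α fun κ y => wΦ (N := N) κ l y)
      (reflSign α l • R0 α (wM (N := N) l)) :=
    solvesKKT_congr (by rw [R1_zero, smul_zero]) hc h1
  have h3 := solvesKKT_shift (bref α l 0) h0
  exact unique_of_solvesKKT h2 h3 (tempered1_smul _ (tempered1_R1 α (tempered_wH l)))
    (tempered1_smul _ (tempered1_R1 α (tempered_wΦ l))) (tempered0_smul _ (tempered0_R0 α (tempered_wM l)))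
    (tempered1_shift _ (tempered_wH l)) (tempered1_shift _ (tempered_wΦ l)) (tempered0_shift _ (tempered_wM l))

/-- Pointwise form of `wH_reflect` for `wH`. [folklore] -/
theorem wH_bref (α κ l : Fin (d + 1)) (z : Fin (d + 1) → ℤ) :
    reflSign α l * (reflSign α κ * wH (N := N) κ l (bref α κ z)) = wH (N := N) κ l (z - (N : ℤ) • bref α l 0) := by
  have h := congrFun (congrFun (wH_reflect (N := N) α l).1 κ) z
  simpa only [Pi.smul_apply, smul_eq_mul, R1_apply] using h

/-- Pointwise form of `wH_reflect` for `wΦ`. [folklore] -/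
theorem wΦ_bref (α κ l : Fin (d + 1)) (y : Fin (d + 1) → ℤ) :
    reflSign α l * (reflSign α κ * wΦ (N := N) κ l (bref α κ y)) = wΦ (N := N) κ l (y - bref α l 0) := by
  have h := congrFun (congrFun (wH_reflect (N := N) α l).2.1 κ) y
  simpa only [Pi.smul_apply, smul_eq_mul, R1_apply] using h

/-- `bref α l q = axisReflect α q + bref α l 0`. [folklore] -/
theorem bref_eq_axisReflect_add (α l : Fin (d + 1)) (q : Fin (d + 1) → ℤ) : bref α l q = axisReflect α q + bref α l 0 := by
  have := bref_add α l 0 q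
  rw [zero_add] at this
  rw [this]
  exact add_comm _ _

/-- **THE PACKED RESOLVENT IS REFLECTION-INVARIANT**: `refK (Φ N α) KInv = KInv` — the hypothesis `hAr` of
`KernelReflection.hess_refl` / `axisReflectionCovariant_flip_hessKer` for the typed `U = 1` one-step system, every axis `α`,
every blocking factor `N ≥ 1`. [folklore] -/
theorem refK_KInv (α : Fin (d + 1)) : refK (Φ N α) (KInv (N := N) (d := d)) = KInv (N := N) := by
  funext x y a b
  rw [refK_apply]
  rcases a with κ | κ <;> rcases b with l | l
  · -- field–field: `Γ`
    simp only [Φ_s_inl, Φ_r_inl, KInv_inl_inl]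
    have h := Gam_bref (N := N) α κ l x (bref α l y)
    rw [bref_bref] at h
    rw [← h]; ring
  · -- field–multiplier: `wH`
    simp only [Φ_s_inl, Φ_s_inr, Φ_r_inl, Φ_r_inr]
    by_cases hy : Torus.proj N y = 0
    · obtain ⟨q, rfl⟩ : ∃ q, y = (N : ℤ) • q := ⟨_, eq_zsmul_quo_of_proj hy⟩
      rw [mref_zsmul, KInv_inl_inr_coarse, KInv_inl_inr_coarse, bref_eq_axisReflect_add α l q, smul_add, ← axisReflect_zsmul,
        ← sub_sub, ← bref_sub]
      have h := wH_bref (N := N) α κ l (bref α κ (x - (N : ℤ) • q))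
      rw [bref_bref] at h
      rw [← h]
      have := reflSign_mul_self α κ
      have := reflSign_mul_self α l
      calc reflSign α κ * reflSign α l * (reflSign α l * (reflSign α κ * wH (N := N) κ l (x - (N : ℤ) • q)))
          = (reflSign α κ * reflSign α κ) * (reflSign α l * reflSign α l) * wH (N := N) κ l (x - (N : ℤ) • q) := by ring
        _ = wH (N := N) κ l (x - (N : ℤ) • q) := by rw [reflSign_mul_self, reflSign_mul_self, one_mul, one_mul]
    · have hy' : Torus.proj N (mref N α l y) ≠ 0 := fun h => hy ((proj_mref_eq_zero_iff α l y).1 h)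
      rw [KInv_inl_inr_off hy', KInv_inl_inr_off hy, mul_zero]
  · -- multiplier–field: `GamΦ`
    simp only [Φ_s_inl, Φ_s_inr, Φ_r_inl, Φ_r_inr]
    by_cases hx : Torus.proj N x = 0
    · obtain ⟨q, rfl⟩ : ∃ q, x = (N : ℤ) • q := ⟨_, eq_zsmul_quo_of_proj hx⟩
      rw [mref_zsmul, KInv_inr_inl_coarse, KInv_inr_inl_coarse]
      have h := GamΦ_bref (N := N) α κ l q (bref α l y)
      rw [bref_bref] at h
      rw [← h]; ring
    · have hx' : Torus.proj N (mref N α κ x) ≠ 0 := fun h => hx ((proj_mref_eq_zero_iff α κ x).1 h)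
      rw [KInv_inr_off hx', KInv_inr_off hx, mul_zero]
  · -- multiplier–multiplier: `wΦ`
    simp only [Φ_s_inr, Φ_r_inr]
    by_cases hx : Torus.proj N x = 0
    · obtain ⟨q, rfl⟩ : ∃ q, x = (N : ℤ) • q := ⟨_, eq_zsmul_quo_of_proj hx⟩
      by_cases hy : Torus.proj N y = 0
      · obtain ⟨q', rfl⟩ : ∃ q', y = (N : ℤ) • q' := ⟨_, eq_zsmul_quo_of_proj hy⟩
        rw [mref_zsmul, mref_zsmul, KInv_inr_inr_coarse, KInv_inr_inr_coarse, bref_eq_axisReflect_add α l q', ← sub_sub,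
          ← bref_sub]
        have h := wΦ_bref (N := N) α κ l (bref α κ (q - q'))
        rw [bref_bref] at h
        rw [← h]
        calc reflSign α κ * reflSign α l * (reflSign α l * (reflSign α κ * wΦ (N := N) κ l (q - q')))
            = (reflSign α κ * reflSign α κ) * (reflSign α l * reflSign α l) * wΦ (N := N) κ l (q - q') := by ring
          _ = wΦ (N := N) κ l (q - q') := by rw [reflSign_mul_self, reflSign_mul_self, one_mul, one_mul]
      · have hy' : Torus.proj N (mref N α l y) ≠ 0 := fun h => hy ((proj_mref_eq_zero_iff α l y).1 h)
        have e1 : KInv (N := N) (mref N α κ ((N : ℤ) • q)) (mref N α l y) (Sum.inr κ) (Sum.inr l) = 0 := by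
          simp only [KInv, hy', and_false, if_false]
        have e2 : KInv (N := N) ((N : ℤ) • q) y (Sum.inr κ) (Sum.inr l) = 0 := by
          simp only [KInv, hy, and_false, if_false]
        rw [e1, e2, mul_zero]
    · have hx' : Torus.proj N (mref N α κ x) ≠ 0 := fun h => hx ((proj_mref_eq_zero_iff α κ x).1 h)
      rw [KInv_inr_off hx', KInv_inr_off hx, mul_zero]

end Resolvent

/-! ## §5 Reflection covariance of the chain-rule vertex and of the resolvent Hessian kernel, for ANY reflection-invariant
packed resolvent -/

section Hessian

variable {d N : ℕ}

/-- The signs of the leg map do not depend on the blocking factor. [folklore] -/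
theorem Φ_s_indep (N N' : ℕ) (α : Fin (d + 1)) (a : Fib d) : (Φ (d := d) N α).s a = (Φ (d := d) N' α).s a := by
  cases a <;> rfl

/-- **REFLECTION COVARIANCE OF THE `ℋ`-COLUMN** of a reflection-invariant packed kernel: the linear response of the background at
the reflected fine bond to the reflected coarse bond is `ε_κ′ ε_μ` times the original one. [folklore] -/
theorem colH_reflect {K : ExpKernelCalculus.MKer (d + 1) (Fib d)} {α : Fin (d + 1)} (hK : refK (Φ N α) K = K)
    (μ : Fin (d + 1)) (y : Fin (d + 1) → ℤ) (κ' : Fin (d + 1)) (u : Fin (d + 1) → ℤ) :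
    colH K N μ (bref α μ y) κ' (bref α κ' u) = reflSign α κ' * reflSign α μ * colH K N μ y κ' u := by
  simp only [colH]
  conv_lhs => rw [← hK]
  rw [refK_apply]
  simp only [Φ_s_inl, Φ_s_inr, Φ_r_inl, Φ_r_inr, bref_bref, mref_zsmul]

/-- **REFLECTION COVARIANCE OF THE CHAIN-RULE VERTEX** through a reflection-invariant packed kernel, for a reflection-covariant
stencil family: `V μ (bref α μ y) = ε_μ • refK Φ (V μ y)` — the hypothesis `hVr` of `KernelReflection.hess_refl` with the bond map
`bondRefl α 1` (`bref_eq_bondRefl`). [folklore] -/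
theorem vertexOfK_reflect {K : ExpKernelCalculus.MKer (d + 1) (Fib d)} {α : Fin (d + 1)} (hK : refK (Φ N α) K = K)
    {S : Fin (d + 1) → (Fin (d + 1) → ℤ) → ExpKernelCalculus.MKer (d + 1) (Fib d)}
    (hSr : ∀ κ' u, S κ' (bref α κ' u) = reflSign α κ' • refK (Φ N α) (S κ' u)) (μ : Fin (d + 1)) (y : Fin (d + 1) → ℤ) :
    vertexOfK K N S μ (bref α μ y) = reflSign α μ • refK (Φ N α) (vertexOfK K N S μ y) := by
  funext x z a b
  simp only [vertexOfK, OneStepResolventKernel.wsum, Pi.smul_apply, smul_eq_mul, refK_apply]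
  have hterm : ∀ κ' : Fin (d + 1), ∑' u, colH K N μ (bref α μ y) κ' u * S κ' u x z a b
      = reflSign α μ * ((Φ N α).s a * (Φ N α).s b) *
          ∑' u, colH K N μ y κ' u * S κ' u ((Φ N α).r a x) ((Φ N α).r b z) a b := by
    intro κ'
    rw [← Equiv.tsum_eq (Function.Involutive.toPerm (bref α κ') (bref_bref α κ'))]
    simp only [Function.Involutive.coe_toPerm]
    rw [← tsum_mul_left]
    refine tsum_congr fun u => ?_
    rw [colH_reflect hK, hSr κ' u]
    simp only [Pi.smul_apply, smul_eq_mul, refK_apply]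
    have h1 := reflSign_mul_self α κ'
    calc reflSign α κ' * reflSign α μ * colH K N μ y κ' u *
          (reflSign α κ' * ((Φ N α).s a * (Φ N α).s b * S κ' u ((Φ N α).r a x) ((Φ N α).r b z) a b))
        = (reflSign α κ' * reflSign α κ') * (reflSign α μ * ((Φ N α).s a * (Φ N α).s b) *
            (colH K N μ y κ' u * S κ' u ((Φ N α).r a x) ((Φ N α).r b z) a b)) := by ring
      _ = _ := by rw [h1, one_mul]
  calc ∑ κ', ∑' u, colH K N μ (bref α μ y) κ' u * S κ' u x z a b
      = ∑ κ', reflSign α μ * ((Φ N α).s a * (Φ N α).s b) *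
          ∑' u, colH K N μ y κ' u * S κ' u ((Φ N α).r a x) ((Φ N α).r b z) a b := Finset.sum_congr rfl fun κ' _ => hterm κ'
    _ = reflSign α μ * ((Φ N α).s a * (Φ N α).s b *
          ∑ κ', ∑' u, colH K N μ y κ' u * S κ' u ((Φ N α).r a x) ((Φ N α).r b z) a b) := by
        rw [← Finset.mul_sum]; ring

/-- The same for the one-step chain-rule vertex `OneStepResolventKernel.vertexOf` (through `KInv`). [folklore] -/
theorem vertexOf_reflect [NeZero N] (α : Fin (d + 1))
    {S : Fin (d + 1) → (Fin (d + 1) → ℤ) → ExpKernelCalculus.MKer (d + 1) (Fib d)}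
    (hSr : ∀ κ' u, S κ' (bref α κ' u) = reflSign α κ' • refK (Φ N α) (S κ' u)) (μ : Fin (d + 1)) (y : Fin (d + 1) → ℤ) :
    vertexOf (N := N) S μ (bref α μ y) = reflSign α μ • refK (Φ N α) (vertexOf (N := N) S μ y) := by
  rw [← vertexOfK_KInv, ← vertexOfK_KInv]
  exact vertexOfK_reflect (refK_KInv α) hSr μ y

/-- **BLOCK-TRANSLATION COVARIANCE OF THE CHAIN-RULE VERTEX** — the statement of
`OneStepKernelFamily.vertexOfK_translate` under the STRICTLY WEAKER stencil hypothesis of BLOCK form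
`S κ′ (u + N•t) = shiftK (−N•t) (S κ′ u)` (coarse `t`), which is the ONLY instance that proof uses (its `hS κ′ u (N•t)`), and the
only form the block stencils of the typed family can meet (`AveragingHessianKernels.vhS_translate`, `packVH_translate`,
`BalabanStepJets.S0_translate` are block-covariant only; an2-g10's BINDER FLAG X-an2-38).  Same six-line proof
(`colH_translate`, `wsum_shift`); stated here so that this leaf's END forms carry a dischargeable (St) socket without touching an4's
leaf.  v1.1. [folklore] -/
theorem vertexOfK_translate_block {K : ExpKernelCalculus.MKer (d + 1) (Fib d)} (hKs : ∀ t, shiftK (-((N : ℤ) • t)) K = K)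
    {S : Fin (d + 1) → (Fin (d + 1) → ℤ) → ExpKernelCalculus.MKer (d + 1) (Fib d)}
    (hS : ∀ (κ' : Fin (d + 1)) (u t : Fin (d + 1) → ℤ), S κ' (u + (N : ℤ) • t) = shiftK (-((N : ℤ) • t)) (S κ' u))
    (μ : Fin (d + 1)) (y t : Fin (d + 1) → ℤ) :
    vertexOfK K N S μ (y + t) = shiftK (-((N : ℤ) • t)) (vertexOfK K N S μ y) := by
  funext x z a b
  simp only [vertexOfK]
  have h : ∀ κ' : Fin (d + 1), OneStepResolventKernel.wsum (colH K N μ (y + t) κ') (S κ')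
      = shiftK (-((N : ℤ) • t)) (OneStepResolventKernel.wsum (colH K N μ y κ') (S κ')) := by
    intro κ'
    have hw : colH K N μ (y + t) κ' = fun u => colH K N μ y κ' (u - (N : ℤ) • t) :=
      funext (OneStepKernelFamily.colH_translate hKs μ y t κ')
    rw [hw]
    exact OneStepResolventKernel.wsum_shift (colH K N μ y κ') ((N : ℤ) • t) fun u => hS κ' u t
  simp only [h, shiftK, vertexOfK]

/-- **THE TYPED REFLECTION LAW OF A RESOLVENT HESSIAN KERNEL, FROM JET COVARIANCE.**  For ANY packed kernel `K` that decays, is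
block-translation covariant and reflection-invariant for every axis, and any jet datum `J` whose stencil family is block-translation
and reflection covariant and whose second-order vertex family is block-translation and reflection covariant, the flipped resolvent
Hessian kernel `flipK (hessKer K (vertexOfK K N J.S) J.W)` satisfies `PolarizationSign.AxisReflectionCovariant` VERBATIM
(`KernelReflection.axisReflectionCovariant_flip_hessKer` with `Φα := Φ N α`, `c := 1`).  The four jet covariances are HYPOTHESES
(binders), never facts. [folklore] -/
theorem axisReflectionCovariant_flipK_hessKer {K : ExpKernelCalculus.MKer (d + 1) (Fib d)}
    (hKd : ∃ δ C : ℝ, 0 < δ ∧ 0 ≤ C ∧ Decays K C δ) (hKs : ∀ t : Fin (d + 1) → ℤ, shiftK (-((N : ℤ) • t)) K = K)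
    (hKr : ∀ α : Fin (d + 1), refK (Φ N α) K = K) (J : JetData d N)
    (hSt : ∀ (κ' : Fin (d + 1)) (u t : Fin (d + 1) → ℤ), J.S κ' (u + (N : ℤ) • t) = shiftK (-((N : ℤ) • t)) (J.S κ' u))
    (hWt : ∀ (μ : Fin (d + 1)) (y : Fin (d + 1) → ℤ) (ν : Fin (d + 1)) (y' t : Fin (d + 1) → ℤ),
      J.W μ (y + t) ν (y' + t) = shiftK (-((N : ℤ) • t)) (J.W μ y ν y'))
    (hSr : ∀ (α κ' : Fin (d + 1)) (u : Fin (d + 1) → ℤ), J.S κ' (bref α κ' u) = reflSign α κ' • refK (Φ N α) (J.S κ' u))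
    (hWr : ∀ (α μ : Fin (d + 1)) (y : Fin (d + 1) → ℤ) (ν : Fin (d + 1)) (y' : Fin (d + 1) → ℤ),
      J.W μ (bref α μ y) ν (bref α ν y') = (reflSign α μ * reflSign α ν) • refK (Φ N α) (J.W μ y ν y')) :
    AxisReflectionCovariant (flipK (hessKer K (vertexOfK K N J.S) J.W)) := by
  obtain ⟨Cv, δv, hδv, hV⟩ := vertexFamily_vertexOfK' (N := N) hKd J.loc J.δ_pos
  obtain ⟨δK, C, hδK, hC, hK⟩ := hKd
  have hCv : 0 ≤ Cv := (hV 0 0).nonneg (Sum.inl 0)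
  have hCw : 0 ≤ J.Cw := (J.loc₂ 0 0 0 0).nonneg (Sum.inl 0)
  have hδ₀ : 0 < min δK (min δv J.δ) := lt_min hδK (lt_min hδv J.δ_pos)
  have hK' : Decays K C (min δK (min δv J.δ)) := decays_mono hK hC le_rfl (min_le_left _ _)
  have hV' : VertexFamily (vertexOfK K N J.S) N Cv (min δK (min δv J.δ)) :=
    fun μ y => biLoc_mono (hV μ y) hCv ((min_le_right _ _).trans (min_le_left _ _))
  have hW' : VertexFamily₂ J.W N J.Cw (min δK (min δv J.δ)) :=
    fun μ y ν y' => biLoc_mono (J.loc₂ μ y ν y') hCw ((min_le_right _ _).trans (min_le_right _ _))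
  have hcov : BlockCovariant K (vertexOfK K N J.S) J.W N := ⟨hKs, vertexOfK_translate_block hKs hSt, hWt⟩
  exact axisReflectionCovariant_flip_hessKer hK' hV' hW' hδ₀ hcov fun α =>
    ⟨Φ N α, hKr α, 1, fun μ y => by rw [← bref_eq_bondRefl]; exact vertexOfK_reflect (hKr α) (hSr α) μ y,
      fun μ y ν y' => by rw [← bref_eq_bondRefl, ← bref_eq_bondRefl]; exact hWr α μ y ν y'⟩

/-- **THE ONE-SHOT / ONE-STEP-AT-`j = 0` CASE**: for the typed kernel `TOf J = hessKer (KInv N) (vertexOf J.S) J.W` of a jet datum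
over the typed `U = 1` system, jet covariance gives `AxisReflectionCovariant (flipK (TOf J))` — every axis, every `N ≥ 1`, any
dimension; the kernel-side inputs (`decays_KInv`, `shiftK_KInv`, `refK_KInv`) are theorems. [folklore] -/
theorem axisReflectionCovariant_flipK_TOf [NeZero N] (J : JetData d N)
    (hSt : ∀ (κ' : Fin (d + 1)) (u t : Fin (d + 1) → ℤ), J.S κ' (u + (N : ℤ) • t) = shiftK (-((N : ℤ) • t)) (J.S κ' u))
    (hWt : ∀ (μ : Fin (d + 1)) (y : Fin (d + 1) → ℤ) (ν : Fin (d + 1)) (y' t : Fin (d + 1) → ℤ),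
      J.W μ (y + t) ν (y' + t) = shiftK (-((N : ℤ) • t)) (J.W μ y ν y'))
    (hSr : ∀ (α κ' : Fin (d + 1)) (u : Fin (d + 1) → ℤ), J.S κ' (bref α κ' u) = reflSign α κ' • refK (Φ N α) (J.S κ' u))
    (hWr : ∀ (α μ : Fin (d + 1)) (y : Fin (d + 1) → ℤ) (ν : Fin (d + 1)) (y' : Fin (d + 1) → ℤ),
      J.W μ (bref α μ y) ν (bref α ν y') = (reflSign α μ * reflSign α ν) • refK (Φ N α) (J.W μ y ν y')) :
    AxisReflectionCovariant (flipK (TOf (N := N) J)) := by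
  have h := axisReflectionCovariant_flipK_hessKer (decays_KInv (N := N) (d := d)) shiftK_KInv refK_KInv J hSt hWt hSr hWr
  have e : vertexOfK (KInv (N := N) (d := d)) N J.S = vertexOf (N := N) J.S :=
    funext fun μ => funext fun y => vertexOfK_KInv J.S μ y
  rw [e] at h
  exact h

end Hessian

/-! ## §6 The reflection commutes with block-contour decimation: the decimated composite resolvents `KInvStep Lc j` are
reflection-invariant, and the typed reflection law of the GENUINE one-step kernels `TstepOf` / `TbalOf` from jet covariance -/

section Decimation

variable {d : ℕ}

/-- The multiplier-leg map scales with an intermediate blocking: `mref (M N) (M • x) = M • mref N x`. [folklore] -/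
theorem mref_mul_zsmul (M N : ℕ) (α κ : Fin D) (x : Fin D → ℤ) :
    mref (M * N) α κ ((M : ℤ) • x) = (M : ℤ) • mref N α κ x := by
  funext i
  simp only [mref, Pi.smul_apply, smul_eq_mul]
  by_cases hi : i = α
  · simp only [hi, if_true]
    by_cases hκ : κ = α <;> simp [hκ] <;> ring
  · simp [hi]

/-- THE INDEX FLIP of the decimation legs under the reflection of axis `α`: block offsets are flipped in the `α`-coordinate, the
contour step of an `α`-contour is reversed; multiplier legs carry a single index. [folklore] -/
def legFlip (M : ℕ) (α : Fin (d + 1)) : Fib d → ((Fin (d + 1) → ℕ) × ℕ) → ((Fin (d + 1) → ℕ) × ℕ)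
  | Sum.inl κ, i => (bflip α M i.1, if κ = α then M - 1 - i.2 else i.2)
  | Sum.inr _, i => i

/-- Membership in the index set of a field leg. [folklore] -/
theorem mem_legSet_inl {M : ℕ} {κ : Fin (d + 1)} {i : (Fin (d + 1) → ℕ) × ℕ} :
    i ∈ legSet d M (Sum.inl κ) ↔ i.1 ∈ box (d + 1) M ∧ i.2 < M := by
  show i ∈ (box (d + 1) M) ×ˢ Finset.range M ↔ _
  rw [Finset.mem_product, Finset.mem_range]

/-- The index flip preserves the leg index sets. [folklore] -/
theorem legFlip_mem {M : ℕ} (α : Fin (d + 1)) {a : Fib d} {i : (Fin (d + 1) → ℕ) × ℕ} (hi : i ∈ legSet d M a) :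
    legFlip M α a i ∈ legSet d M a := by
  rcases a with κ | κ
  · obtain ⟨hr, hs⟩ := mem_legSet_inl.1 hi
    refine mem_legSet_inl.2 ⟨bflip_mem α hr, ?_⟩
    simp only [legFlip]
    split_ifs <;> omega
  · exact hi

/-- The index flip is an involution on the leg index sets. [folklore] -/
theorem legFlip_legFlip {M : ℕ} (α : Fin (d + 1)) {a : Fib d} {i : (Fin (d + 1) → ℕ) × ℕ} (hi : i ∈ legSet d M a) :
    legFlip M α a (legFlip M α a i) = i := by
  rcases a with κ | κ
  · obtain ⟨hr, hs⟩ := mem_legSet_inl.1 hi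
    apply Prod.ext
    · simp only [legFlip]; exact bflip_bflip α hr
    · simp only [legFlip]; split_ifs <;> omega
  · rfl

/-- Reindexing a leg sum by the index flip. [folklore] -/
theorem sum_legFlip {β : Type*} [AddCommMonoid β] (M : ℕ) (α : Fin (d + 1)) (a : Fib d) (g : ((Fin (d + 1) → ℕ) × ℕ) → β) :
    ∑ i ∈ legSet d M a, g (legFlip M α a i) = ∑ i ∈ legSet d M a, g i :=
  Finset.sum_nbij' (legFlip M α a) (legFlip M α a) (fun _ hi => legFlip_mem α hi) (fun _ hi => legFlip_mem α hi)
    (fun _ hi => legFlip_legFlip α hi) (fun _ hi => legFlip_legFlip α hi) (fun _ _ => rfl)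

/-- **THE LEG POINTS ARE EQUIVARIANT**: the fine reflection (blocking `M N`) of the leg point of index `i` over the step point `x′`
is the leg point of the flipped index over the reflected step point (blocking `N` on the step lattice). [folklore] -/
theorem legPt_reflect {M N : ℕ} (α : Fin (d + 1)) (a : Fib d) (x' : Fin (d + 1) → ℤ) {i : (Fin (d + 1) → ℕ) × ℕ}
    (hi : i ∈ legSet d M a) :
    (Φ (d := d) (M * N) α).r a (legPt M a x' i) = legPt M a ((Φ (d := d) N α).r a x') (legFlip M α a i) := by
  rcases a with κ | κ
  · obtain ⟨hr, hs⟩ := mem_legSet_inl.1 hi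
    have hrα : i.1 α < M := mem_box.1 hr α
    have h1 : ((M - 1 - i.1 α : ℕ) : ℤ) = (M : ℤ) - 1 - (i.1 α : ℤ) := by omega
    have h2 : ((M - 1 - i.2 : ℕ) : ℤ) = (M : ℤ) - 1 - (i.2 : ℤ) := by omega
    simp only [Φ_r_inl, legPt, legFlip]
    funext j
    simp only [bref_apply, Pi.add_apply, Pi.smul_apply, smul_eq_mul, bflip, Nat.cast_ite]
    by_cases hj : j = α
    · subst hj
      by_cases hκ : κ = j
      · subst hκ
        simp only [if_true, h1, h2]
        ring
      · have hκ' : ¬j = κ := fun h => hκ h.symm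
        simp only [if_true, hκ, hκ', if_false, h1]
        ring
    · simp only [hj, if_false]
      by_cases hjκ : j = κ
      · have hκα : ¬κ = α := fun h => hj (hjκ.trans h)
        simp only [hjκ, hκα, if_true, if_false]
      · simp only [hjκ, if_false]
  · simp only [Φ_r_inr, legPt]
    exact mref_mul_zsmul M N α κ x'

/-- **THE REFLECTION COMMUTES WITH BLOCK-CONTOUR DECIMATION**: reflecting the decimated kernel on the step lattice (blocking `N`)
is decimating the kernel reflected on the fine lattice (blocking `M N`). [folklore] -/
theorem refK_dec (M N : ℕ) (α : Fin (d + 1)) (K : ExpKernelCalculus.MKer (d + 1) (Fib d)) :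
    refK (Φ (d := d) N α) (dec M K) = dec M (refK (Φ (d := d) (M * N) α) K) := by
  funext x' y' a b
  rw [refK_apply]
  simp only [dec, Finset.mul_sum]
  refine Finset.sum_nbij' (legFlip M α a) (legFlip M α a) (fun _ hi => legFlip_mem α hi) (fun _ hi => legFlip_mem α hi)
    (fun _ hi => legFlip_legFlip α hi) (fun _ hi => legFlip_legFlip α hi) (fun i hi => ?_)
  refine Finset.sum_nbij' (legFlip M α b) (legFlip M α b) (fun _ hi => legFlip_mem α hi) (fun _ hi => legFlip_mem α hi)
    (fun _ hi => legFlip_legFlip α hi) (fun _ hi => legFlip_legFlip α hi) (fun i' hi' => ?_)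
  rw [refK_apply, legPt_reflect α a x' (legFlip_mem α hi), legPt_reflect α b y' (legFlip_mem α hi'), legFlip_legFlip α hi,
    legFlip_legFlip α hi', Φ_s_indep (M * N) N α a, Φ_s_indep (M * N) N α b]
  ring

/-- **THE DECIMATED COMPOSITE RESOLVENTS ARE REFLECTION-INVARIANT**: `refK (Φ Lc α) (KInvStep Lc j) = KInvStep Lc j` — every
axis, every step `j`, every `Lc ≥ 1`, any dimension. [folklore] -/
theorem refK_KInvStep {Lc : ℕ} [NeZero Lc] (j : ℕ) (α : Fin (d + 1)) :
    refK (Φ (d := d) Lc α) (KInvStep (d := d) Lc j) = KInvStep (d := d) Lc j := by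
  unfold KInvStep
  rw [refK_dec, show Lc ^ j * Lc = Lc ^ (j + 1) from (pow_succ Lc j).symm, refK_KInv]

/-- **THE TYPED REFLECTION LAW OF THE GENUINE STEP-`j` KERNEL FROM JET COVARIANCE**: for step jet data `J` (blocking `Lc` on the
step-`j` lattice) with block-translation and reflection covariant stencils and block-translation and reflection covariant second-order
vertices, `AxisReflectionCovariant (flipK (TstepOf Lc j J))`. [folklore] -/
theorem axisReflectionCovariant_flipK_TstepOf {Lc : ℕ} [NeZero Lc] (j : ℕ) (J : JetData d Lc)
    (hSt : ∀ (κ' : Fin (d + 1)) (u t : Fin (d + 1) → ℤ), J.S κ' (u + (Lc : ℤ) • t) = shiftK (-((Lc : ℤ) • t)) (J.S κ' u))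
    (hWt : ∀ (μ : Fin (d + 1)) (y : Fin (d + 1) → ℤ) (ν : Fin (d + 1)) (y' t : Fin (d + 1) → ℤ),
      J.W μ (y + t) ν (y' + t) = shiftK (-((Lc : ℤ) • t)) (J.W μ y ν y'))
    (hSr : ∀ (α κ' : Fin (d + 1)) (u : Fin (d + 1) → ℤ), J.S κ' (bref α κ' u) = reflSign α κ' • refK (Φ Lc α) (J.S κ' u))
    (hWr : ∀ (α μ : Fin (d + 1)) (y : Fin (d + 1) → ℤ) (ν : Fin (d + 1)) (y' : Fin (d + 1) → ℤ),
      J.W μ (bref α μ y) ν (bref α ν y') = (reflSign α μ * reflSign α ν) • refK (Φ Lc α) (J.W μ y ν y')) :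
    AxisReflectionCovariant (flipK (TstepOf Lc j J)) := by
  unfold TstepOf
  exact axisReflectionCovariant_flipK_hessKer (decays_KInvStep j) (shiftK_KInvStep j) (fun α => refK_KInvStep j α) J hSt
    hWt hSr hWr

/-- **THE `hR` BINDER OF `OneStepKernelFamily.d1Drift_of_D1Tel_D1Rep` FROM JET COVARIANCE** (dimension four, the one-step
family `TbalOf Lc Js`): if every step jet datum `Js j` has covariant stencils and second-order vertices (four binders per `j`),
then `∀ j, AxisReflectionCovariant (flipK (TbalOf Lc Js j))` — the typed (5.7)–(5.8) law of the cell's `hR`, with ALL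
kernel-side content (decay, block covariance and reflection invariance of every `KInvStep Lc j`) discharged here.  What is NOT
discharged is the jet covariance itself — see the module docstring, THE DRESSED FAMILY. [folklore] -/
theorem axisReflectionCovariant_flipK_TbalOf {Lc : ℕ} [NeZero Lc] (Js : ℕ → JetData 3 Lc)
    (hSt : ∀ (j : ℕ) (κ' : Fin 4) (u t : Fin 4 → ℤ), (Js j).S κ' (u + (Lc : ℤ) • t) = shiftK (-((Lc : ℤ) • t)) ((Js j).S κ' u))
    (hWt : ∀ (j : ℕ) (μ : Fin 4) (y : Fin 4 → ℤ) (ν : Fin 4) (y' t : Fin 4 → ℤ),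
      (Js j).W μ (y + t) ν (y' + t) = shiftK (-((Lc : ℤ) • t)) ((Js j).W μ y ν y'))
    (hSr : ∀ (j : ℕ) (α κ' : Fin 4) (u : Fin 4 → ℤ),
      (Js j).S κ' (bref α κ' u) = reflSign α κ' • refK (Φ Lc α) ((Js j).S κ' u))
    (hWr : ∀ (j : ℕ) (α μ : Fin 4) (y : Fin 4 → ℤ) (ν : Fin 4) (y' : Fin 4 → ℤ),
      (Js j).W μ (bref α μ y) ν (bref α ν y') = (reflSign α μ * reflSign α ν) • refK (Φ Lc α) ((Js j).W μ y ν y')) :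
    ∀ j : ℕ, AxisReflectionCovariant (flipK (TbalOf Lc Js j)) :=
  fun j => axisReflectionCovariant_flipK_TstepOf j (Js j) (hSt j) (hWt j) (hSr j) (hWr j)

end Decimation

end

end Literature.MathematicalPhysics.QuantumFieldTheory.Balaban1983to89.Beta.ResolventReflection
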